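import Mathlib
import Literature.NumberTheory.LFunctions.Zhang2022.Section16Eval1617R2
import Literature.NumberTheory.LFunctions.Zhang2022.TypedSection16BE
import Literature.NumberTheory.LFunctions.Zhang2022.SkeletonEvalRelE
import HarnessLib

/-!
# Zhang (2022), §16 p. 95 at a PARAMETRISED value of `e″₁ⱼ` (RT-05 E-ports):
# `(16.12) + (16.16)ᴿ²ᴱ + u044 ⇒ Φ₂(p) = −(𝔢₁+𝔢₂)[e1pp]𝔞p + o((𝔞+1)p)` and `(16.2) + that ⇒ (16.17)ᴿᴱ`
# — the producer `eval1617RelE_of_R2E : … → Eq16_16R2E e1pp c′ → Skeleton.Eval1617RelE e1pp c′`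

Topic `Literature/NumberTheory/LFunctions/Zhang2022` (Landau–Siegel audit tree; verdict-neutral).
Y. Zhang, *Discrete mean estimates and the Landau–Siegel zero*, arXiv:2211.02515v1 (2022)
[Zhang2022LandauSiegel] — **an unrefereed manuscript under adjudication**; the displays referred to are
CLAIM nodes (`Typed.Section16A`, `Typed.Section16B`/`TypedSection16BE`, `SkeletonPartThree`,
`SkeletonEvalRelE`), stated not asserted; nothing here bears on Theorems 1–2 of the source or on
Landau–Siegel zeros. ZHANG-L discharge lane (seat zl-libC-typer, R-10 float), zl-lead rulings R-22/R-28 =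
RE-TYPE RT-05 (the `e″₁ⱼ`-fork) on top of R-17/R-30 (RT-03, two-piece (16.16)).

WHY. Under RT-05 the skeleton carries the §15–§18 evaluation chain PARAMETRISED over the value `e1pp` of
`e″₁ⱼ` (`Section18DefsE.frakeE`, `SkeletonEvalRelE.Eval1617RelE e1pp c′`, …) and instantiates it at the
DERIVED `AppendixB.e1ppD` (`e″₁ⱼ = −jπi·b*`, App. B's own computation — rows G-L4t10-1 / G-num2-1 /
D-G-num2-1 — NOT the value stated in Lemma 15.1/(B.3)); the binder of record for leaf h16_16 becomes
`Typed.Section16B.Eq16_16R2E e1ppD c′`, and the pen's E-rethread needs the §16 producer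
`… → Eq16_16R2E e1pp c′ → Skeleton.Eval1617RelE e1pp c′` (zl-skel, INBOX 2026-08-27T00:11:44Z). This file
is the E-form of zl-w16-p4's `Section16Eval1617R2` (p474283) and of the cell's `Section16Eval1617Rel`
endgame: the SAME proofs with `frake j ↦ frakeE e1pp j` — indeed with an ARBITRARY family `e : ℕ → ℂ`
resp. constant `E : ℂ` in place of `𝔢ⱼ` resp. `𝔢₁+𝔢₂`, since the endgame never inspects their values
(R-28 C4; the generic cores `Skeleton.endgame_core2` / `cross_piece_le` of p474283 already take `e₁, e₂`
as parameters and are used BY NAME). PROVED here (theorems only; no definitions, no named facts):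

* `phi2p_evalRel_of_parts2_gen (e : ℕ → ℂ)` — for ANY `Φ₂(p)`, `𝓡₂*`, `𝓡₂ⱼ`, `𝒮₂ⱼ` and ANY constants
  `e j`: (16.12) + `‖𝒮₂ⱼ − 𝔞e_j(φ/D)L′‖ ≤ C(𝓛⁻¹ + (1+|L′|)³𝓛⁻⁴)` + u044 + the tree's Lemma 5.7/(2.31)/Lemma 3.1
  sizes ⇒ `‖Φ₂(p) + (e₁+e₂)𝔞p‖ ≤ ε(𝔞+1)p` uniformly for `p ∼ P`, all large `D` under (A) (no size input on `𝔞`);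
* `eval1617Rel_of_parts_gen (E : ℂ)` — (16.2) + `‖Φ₂(p) + E𝔞p‖ ≤ ε(𝔞+1)p` on the window ⇒
  `‖Φ₂ − E𝔞𝔓‖ ≤ ε(𝔞+1)𝔓` (the exact identity of `Skeleton.eval1617Rel_of_parts`; "`(pt₀)^{β₁} = −1 + O(α₁)`"
  is the tree's `norm_primeWindow_cpow_beta1_add_one_le`, the `O(α₁𝔞𝔓)` term is absorbed by `frakA_le`);
* on the typed E-nodes: `step16_u045RelE_of_R2E` ((16.12) + `Eq16_16R2E e1pp` ⇒ relative u045 at the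
  parameter, u044 being the tree theorem `ResidueValues.step16_u044_holds`) and
  **`eval1617RelE_of_R2E (e1pp) (c′) : Prop141 → Step16_u010 c′ → Eq16_12 c′ → Eq16_16R2E e1pp c′ →
  Eval1617RelE e1pp c′`** — the §16 E-producer the pen asked for ((16.2) ⇐ Prop. 14.1 + u010 is the tree's
  `Skeleton.eq16_2_of_prop141`);
* an `example` — sanity (R-28 C4): at `e1pp = e1ppj` the E-producer IS the RT-03 precondition of record
  (zl-w16-p4's landed `Skeleton.eval1617Rel_of_eq16_16R2`; bridges `eval1617RelE_e1ppj_iff`, `eq16_16R2E_e1ppj`).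

vs PRINT (R-23): REPAIRED-OF-RECORD per rows G-L4t5-1/G-L4t5-2/G-d57-1 (two-piece rate) and G-L4t10-1 /
G-num2-1 (constant read at the parameter; instance of record `e1ppD`). Axioms standard.

## References

* Y. Zhang, arXiv:2211.02515v1 (2022), §16 (16.2), (16.12), (16.16), (16.17), p. 95, tex L4670–L4687;
  §5 Lemma 5.7; §2 (2.13), (2.31); §3 Lemma 3.1; §15 Lemma 15.1 p. 86; App. B (B.3).
  [cite: Zhang2022LandauSiegel, §16 (16.17) p.95]
-/

noncomputable section

open Complex Real

namespace Literature.NumberTheory.LFunctions.Zhang2022.Skeleton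

/-! ## The endgame with arbitrary constants in place of `𝔢₁, 𝔢₂` -/

section Generic

/-- **§16 p. 95, "This together with (16.16) and (16.12) yields `Φ₂(p) = −(𝔢₁+𝔢₂)𝔞p + o(p)`" in the
RELATIVE reading, from the TWO-PIECE (16.16), with ARBITRARY constants `e j` in place of `𝔢ⱼ`** (DAG
`Z22:§16.u045` ⇐ `Z22:(16.12)` + `Z22:(16.16)`ᴿ² + `Z22:§16.u044`; generic-constant form of zl-w16-p4's
`phi2p_evalRel_of_parts2`, p474283 — same proof, the value of `e j` is never inspected): for ANY `Φ₂(p)`,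
`𝓡₂*`, `𝓡₂ⱼ`, `𝒮₂ⱼ`, from (16.12), `‖𝒮₂ⱼ − 𝔞e_j(φ/D)L′‖ ≤ C(𝓛⁻¹ + (1+|L′|)³𝓛⁻⁴)`, the `𝓡₂*𝓡₂ⱼ` display
u044 and the tree's Lemma 5.7 / (2.31) / Lemma 3.1 sizes: `‖Φ₂(p) + (e₁+e₂)𝔞p‖ ≤ ε(𝔞+1)p` uniformly for
`p ∼ P`, for all large `D` under (A) — NO size input on `𝔞` (`endgame_core2`).
[cite: Zhang2022LandauSiegel, §16 p.95] -/
theorem phi2p_evalRel_of_parts2_gen (e : ℕ → ℂ)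
    (Φ : (D : ℕ) → [NeZero D] → DirichletCharacter ℂ D → ℕ → ℂ)
    (Rs : (D : ℕ) → [NeZero D] → DirichletCharacter ℂ D → ℂ)
    (R S : (D : ℕ) → [NeZero D] → DirichletCharacter ℂ D → ℕ → ℂ)
    (h1612 : ∀ ε : ℝ, 0 < ε → ForAllLarge fun D _ χ => AssumptionA D χ → ∀ p ∈ primeWindow D,
      ‖Φ D χ p - Rs D χ * ((D : ℝ) * p : ℝ) / (Nat.totient D : ℂ) *
        ∑ j ∈ ({1, 2} : Finset ℕ), R D χ j * S D χ j‖ ≤ ε * p)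
    (h1616 : ∃ C : ℝ, ForAllLarge fun D _ χ => AssumptionA D χ → ∀ j ∈ ({1, 2} : Finset ℕ),
      ‖S D χ j - (frakA χ : ℂ) * e j * ((Nat.totient D : ℂ) / (D : ℂ)) * deriv χ.LFunction 1‖ ≤
        C * ((ell D)⁻¹ + (1 + ‖deriv χ.LFunction 1‖) ^ 3 * (ell D ^ 4)⁻¹))
    (h44 : ∃ C : ℝ, ForAllLarge fun D _ χ => AssumptionA D χ → ∀ j ∈ ({1, 2} : Finset ℕ),
      ‖Rs D χ * R D χ j + 1 / deriv χ.LFunction 1‖ ≤ C * (ell D)⁻¹ * ‖deriv χ.LFunction 1‖⁻¹) :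
    ∀ ε : ℝ, 0 < ε → ForAllLarge fun D _ χ => AssumptionA D χ → ∀ p ∈ primeWindow D,
      ‖Φ D χ p + (e 1 + e 2) * frakA χ * p‖ ≤ ε * (frakA χ + 1) * p := by
  intro ε hε
  obtain ⟨C₁, hC₁⟩ := h1616
  obtain ⟨C₂, hC₂⟩ := h44
  set C₁' : ℝ := max C₁ 0 with hC₁'
  set C₂' : ℝ := max C₂ 0 with hC₂'
  have hC₁'0 : 0 ≤ C₁' := le_max_right _ _
  have hC₂'0 : 0 ≤ C₂' := le_max_right _ _
  set E : ℝ := ‖e 1‖ + ‖e 2‖ with hE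
  have hE0 : 0 ≤ E := by positivity
  have hε3 : 0 < ε / 3 := by positivity
  set A : ℝ := 2 * (1 + C₂') * (20 * Real.exp 1 * C₁') with hA
  set B : ℝ := 2 * (1 + C₂') * (64 * π ^ 2 / 3 * Real.exp 1 * Real.exp (9 / 2) * C₁') + C₂' * E
    with hB
  have hA0 : 0 ≤ A := by positivity
  have hB0 : 0 ≤ B := by positivity
  obtain ⟨Dl, hDl⟩ := self_div_totient_le_norm_deriv_L_one
  obtain ⟨D₁, h₁⟩ := ((h1612 _ hε3).and hC₁).and hC₂
  obtain ⟨D₂, h₂⟩ := exists_forall_le_ell (max 3 (3 * (A + B) / ε))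
  refine ⟨max (max D₁ D₂) Dl, fun D _ χ hD hq hp hA' p hpW => ?_⟩
  have hD1 : D₁ ≤ D := le_trans (le_trans (le_max_left _ _) (le_max_left _ _)) hD
  have hD2 : D₂ ≤ D := le_trans (le_trans (le_max_right _ _) (le_max_left _ _)) hD
  have hDl' : Dl ≤ D := le_trans (le_max_right _ _) hD
  obtain ⟨⟨e12, e16⟩, e44⟩ := h₁ D χ hD1 hq hp
  have hM := h₂ D hD2
  have hℓ3 : 3 ≤ ell D := le_trans (le_max_left _ _) hM
  have hℓK : 3 * (A + B) / ε ≤ ell D := le_trans (le_max_right _ _) hM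
  have hℓ1 : 1 ≤ ell D := by linarith
  have hℓ0 : 0 < ell D := by linarith
  have hLge := hDl D χ hDl' hq hp hA'
  -- `L′(1,χ) ≠ 0`
  have hρpos : 0 < (D : ℝ) / Nat.totient D := by
    have := NeZero.pos D
    have hφ := Nat.totient_pos.mpr this
    positivity
  have hL0 : deriv χ.LFunction 1 ≠ 0 := by
    intro h
    rw [h, norm_zero, mul_zero] at hLge
    linarith
  -- `χ ≠ 1` (`D ≥ 2` as `log D ≥ 3`), so `L′(1,χ)` is real and the (2.31)/Lemma 3.1 sizes apply
  have hD2 : 2 ≤ D := by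
    by_contra hlt
    have hD1' : D ≤ 1 := by omega
    have : Real.log (D : ℝ) ≤ 0 := by
      rcases Nat.le_one_iff_eq_zero_or_eq_one.mp hD1' with h0 | h1
      · simp [h0]
      · simp [h1]
    have hℓdef : ell D = Real.log D := rfl
    linarith
  have hχ1 : χ ≠ 1 := Lemma31.ne_one_of_isPrimitive χ hD2 hp
  have hLa : ‖deriv χ.LFunction 1‖ ^ 2 ≤ π ^ 2 / 6 * (1 + ell D) * frakA χ :=
    norm_deriv_sq_le_mul_frakA χ hχ1 hq.sq_eq_one
  have hLu : ‖deriv χ.LFunction 1‖ ≤ 2 * Real.exp (9 / 2) * (1 + ell D) * ell D := by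
    have h := Lemma31.norm_deriv_LFunction_le_near_one χ (q := D) hℓ3 hp (w := 1)
      (by rw [sub_self, norm_zero]; positivity)
    exact h
  have h1mem : (1 : ℕ) ∈ ({1, 2} : Finset ℕ) := by simp
  have h2mem : (2 : ℕ) ∈ ({1, 2} : Finset ℕ) := by simp
  -- the inputs at this `D, χ, p`
  have g12 := e12 hA' p hpW
  rw [Finset.sum_pair (by norm_num : (1 : ℕ) ≠ 2)] at g12
  have hW0 : 0 ≤ (ell D)⁻¹ + (1 + ‖deriv χ.LFunction 1‖) ^ 3 * (ell D ^ 4)⁻¹ := by positivity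
  have g16₁ : ‖S D χ 1 - (frakA χ : ℂ) * e 1 * ((Nat.totient D : ℂ) / (D : ℂ)) *
      deriv χ.LFunction 1‖ ≤ C₁' * ((ell D)⁻¹ + (1 + ‖deriv χ.LFunction 1‖) ^ 3 * (ell D ^ 4)⁻¹) :=
    (e16 hA' 1 h1mem).trans (mul_le_mul_of_nonneg_right (le_max_left _ _) hW0)
  have g16₂ : ‖S D χ 2 - (frakA χ : ℂ) * e 2 * ((Nat.totient D : ℂ) / (D : ℂ)) *
      deriv χ.LFunction 1‖ ≤ C₁' * ((ell D)⁻¹ + (1 + ‖deriv χ.LFunction 1‖) ^ 3 * (ell D ^ 4)⁻¹) :=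
    (e16 hA' 2 h2mem).trans (mul_le_mul_of_nonneg_right (le_max_left _ _) hW0)
  have hy : 0 ≤ (ell D)⁻¹ * ‖deriv χ.LFunction 1‖⁻¹ := by positivity
  have g44₁ : ‖Rs D χ * R D χ 1 + 1 / deriv χ.LFunction 1‖ ≤
      C₂' * (ell D)⁻¹ * ‖deriv χ.LFunction 1‖⁻¹ := by
    refine (e44 hA' 1 h1mem).trans ?_
    rw [mul_assoc, mul_assoc]
    exact mul_le_mul_of_nonneg_right (le_max_left _ _) hy
  have g44₂ : ‖Rs D χ * R D χ 2 + 1 / deriv χ.LFunction 1‖ ≤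
      C₂' * (ell D)⁻¹ * ‖deriv χ.LFunction 1‖⁻¹ := by
    refine (e44 hA' 2 h2mem).trans ?_
    rw [mul_assoc, mul_assoc]
    exact mul_le_mul_of_nonneg_right (le_max_left _ _) hy
  have hA0' : 0 ≤ frakA χ := frakA_nonneg χ
  have key := endgame_core2 (Φ := Φ D χ p) (Rs := Rs D χ) (e₁ := e 1) (e₂ := e 2) hL0
    (Nat.totient_pos.mpr (NeZero.pos D)) (NeZero.pos D) hA0' hC₁'0 hC₂'0 hℓ1 hLge hLa hLu
    g12 g16₁ g16₂ g44₁ g44₂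
  refine key.trans ?_
  have hp0 : (0 : ℝ) ≤ p := Nat.cast_nonneg p
  refine mul_le_mul_of_nonneg_right ?_ hp0
  -- `ε/3 + A𝓛⁻¹ + B𝔞𝓛⁻¹ ≤ ε(𝔞+1)` from `3(A+B)/ε ≤ 𝓛`
  have hℓK' : 3 * (A + B) ≤ ell D * ε := by rwa [div_le_iff₀ hε] at hℓK
  have hAℓ : A * (ell D)⁻¹ ≤ ε / 3 := by
    rw [← div_eq_mul_inv, div_le_iff₀ hℓ0]; linarith
  have hBℓ : B * (ell D)⁻¹ ≤ ε / 3 := by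
    rw [← div_eq_mul_inv, div_le_iff₀ hℓ0]; linarith
  have hBaℓ : B * frakA χ * (ell D)⁻¹ ≤ ε / 3 * frakA χ := by
    have := mul_le_mul_of_nonneg_right hBℓ hA0'
    calc B * frakA χ * (ell D)⁻¹ = B * (ell D)⁻¹ * frakA χ := by ring
      _ ≤ ε / 3 * frakA χ := this
  have hfold : ε / 3 + 2 * (1 + C₂') * (20 * Real.exp 1 * C₁') * (ell D)⁻¹ +
      (2 * (1 + C₂') * (64 * π ^ 2 / 3 * Real.exp 1 * Real.exp (9 / 2) * C₁') +
        C₂' * (‖e 1‖ + ‖e 2‖)) * frakA χ * (ell D)⁻¹ =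
      ε / 3 + A * (ell D)⁻¹ + B * frakA χ * (ell D)⁻¹ := by rw [hA, hB, hE]
  rw [hfold]
  have hεA : 0 ≤ ε * frakA χ := mul_nonneg hε.le hA0'
  linarith

/-- **"which together with (16.2) gives (16.17)" in the RELATIVE reading, with an ARBITRARY constant `E`
in place of `𝔢₁+𝔢₂`** (§16 p. 95, tex L4684–4687, DAG `Z22:(16.17)` ⇐ `Z22:(16.2)` + `Z22:§16.u045`;
generic-constant form of the cell's `Skeleton.eval1617Rel_of_parts`): for ANY `Φ₂(p)` and ANY `E : ℂ`, if
"`Φ₂ = Σ_{p∼P}(pt₀)^{β₁}Φ₂(p) + o(𝔓)`" (16.2) and `‖Φ₂(p) + E𝔞p‖ ≤ ε(𝔞+1)p` uniformly for `p ∼ P`, then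
`‖Φ₂ − E𝔞𝔓‖ ≤ ε(𝔞+1)𝔓` eventually — the body of `Skeleton.Eval1617RelE e1pp c′` at `E = 𝔢₁[e1pp]+𝔢₂[e1pp]`.
Same exact identity as the original; "`(pt₀)^{β₁} = −1 + O(α₁)`" is `norm_primeWindow_cpow_beta1_add_one_le`
and `O(α₁𝔞𝔓) = o(𝔓)` is `frakA_le`; the value of `E` is never inspected.
[cite: Zhang2022LandauSiegel, §16 (16.17)] -/
theorem eval1617Rel_of_parts_gen (c' : ℝ) (E : ℂ)
    (Φ : (D : ℕ) → [NeZero D] → DirichletCharacter ℂ D → ℕ → ℂ)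
    (h162 : ∀ ε : ℝ, 0 < ε → ForAllLarge fun D _ χ => AssumptionA D χ →
      ‖Phi2 c' χ - ∑ p ∈ primeWindow D, (((p : ℝ) * t0 D : ℝ) : ℂ) ^ beta1 c' D * Φ D χ p‖ ≤
        ε * frakP D)
    (hΦ : ∀ ε : ℝ, 0 < ε → ForAllLarge fun D _ χ => AssumptionA D χ → ∀ p ∈ primeWindow D,
      ‖Φ D χ p + E * frakA χ * p‖ ≤ ε * (frakA χ + 1) * p) :
    ∀ ε : ℝ, 0 < ε → ForAllLarge fun D _ χ => AssumptionA D χ →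
      ‖Phi2 c' χ - E * frakA χ * frakP D‖ ≤ ε * (frakA χ + 1) * frakP D := by
  intro ε hε
  have hε3 : 0 < ε / 3 := by positivity
  obtain ⟨D₁, h₁⟩ := (h162 _ hε3).and (hΦ _ hε3)
  -- the constant of the third error term and the threshold on `𝓛`
  set K : ℝ := (523 + 2635 * |c'|) * ‖E‖ * (16 * Real.exp 9) * π with hK
  have hK0 : 0 ≤ K := by positivity
  obtain ⟨D₂, h₂⟩ := exists_forall_le_ell (max 3 (3 * K / ε + 1))
  refine ⟨max D₁ D₂, fun D _ χ hD hq hp hA => ?_⟩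
  obtain ⟨e162, eΦ⟩ := h₁ D χ (le_trans (le_max_left _ _) hD) hq hp
  replace e162 := e162 hA
  replace eΦ := eΦ hA
  have hM := h₂ D (le_trans (le_max_right _ _) hD)
  have hℓ3 : 3 ≤ ell D := le_trans (le_max_left _ _) hM
  have hℓK : 3 * K / ε + 1 ≤ ell D := le_trans (le_max_right _ _) hM
  have hℓ0 : 0 < ell D := by linarith
  have hℓ1 : 1 ≤ ell D := by linarith
  -- `K/𝓛⁴ ≤ ε/3`
  have hℓ4 : 3 * K / ε ≤ ell D ^ 4 := by
    have : ell D ≤ ell D ^ 4 := le_self_pow₀ hℓ1 (by norm_num)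
    linarith
  have hKε : K / ell D ^ 4 ≤ ε / 3 := by
    rw [div_le_iff₀ (by positivity)]
    have : 3 * K ≤ ell D ^ 4 * ε := by rwa [div_le_iff₀ hε] at hℓ4
    linarith
  -- the two inputs on the window
  have hα5 : alpha D * ell D * ell D ^ 4 = π / ell D ^ 4 := by
    have h9 := alpha_mul_ell_pow_nine (D := D) hℓ0
    field_simp
    linear_combination h9
  have hα : 0 < alpha D := alpha_pos_of_ell_pos hℓ0
  have hAle : frakA χ ≤ 16 * Real.exp 9 * ell D ^ 4 := frakA_le χ hℓ3 hp
  have hA0 : 0 ≤ frakA χ := frakA_nonneg χ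
  have hA1 : 1 ≤ frakA χ + 1 := by linarith
  -- abbreviation for the weights
  set w : ℕ → ℂ := fun p => (((p : ℝ) * t0 D : ℝ) : ℂ) ^ beta1 c' D with hw
  have hw1 : ∀ p ∈ primeWindow D, ‖w p‖ = 1 := fun p hp' =>
    norm_primeWindow_cpow_beta1 c' hℓ0 hp'
  have hw2 : ∀ p ∈ primeWindow D, ‖w p + 1‖ ≤ (523 + 2635 * |c'|) * (alpha D * ell D) :=
    fun p hp' => norm_primeWindow_cpow_beta1_add_one_le c' hℓ3 hp'
  -- `𝔓 = Σ_{p∼P} p`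
  have hP : (frakP D : ℂ) = ∑ p ∈ primeWindow D, (p : ℂ) := by
    rw [frakP_eq_sum_primeWindow]; push_cast; rfl
  -- the exact decomposition
  have hsum : ∑ p ∈ primeWindow D, w p * (Φ D χ p + E * frakA χ * p) -
      ∑ p ∈ primeWindow D, (w p + 1) * (E * frakA χ * p) =
      ∑ p ∈ primeWindow D, w p * Φ D χ p - ∑ p ∈ primeWindow D, E * frakA χ * p := by
    rw [← Finset.sum_sub_distrib, ← Finset.sum_sub_distrib]
    exact Finset.sum_congr rfl fun p _ => by ring
  have key : Phi2 c' χ - E * frakA χ * frakP D =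
      (Phi2 c' χ - ∑ p ∈ primeWindow D, w p * Φ D χ p) +
      (∑ p ∈ primeWindow D, w p * (Φ D χ p + E * frakA χ * p) -
        ∑ p ∈ primeWindow D, (w p + 1) * (E * frakA χ * p)) := by
    rw [hsum, hP, Finset.mul_sum]; ring
  -- termwise bounds
  have hB : ∀ p ∈ primeWindow D, ‖w p * (Φ D χ p + E * frakA χ * p)‖ ≤
      ε / 3 * (frakA χ + 1) * p := by
    intro p hp'
    rw [norm_mul, hw1 p hp', one_mul]
    exact eΦ p hp'
  have hC : ∀ p ∈ primeWindow D, ‖(w p + 1) * (E * frakA χ * p)‖ ≤ K / ell D ^ 4 * p := by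
    intro p hp'
    have hn : ‖(E * frakA χ * p : ℂ)‖ = ‖E‖ * frakA χ * p := by
      rw [norm_mul, norm_mul, Complex.norm_real, Real.norm_of_nonneg hA0, Complex.norm_natCast]
    rw [norm_mul, hn]
    calc ‖w p + 1‖ * (‖E‖ * frakA χ * p)
        ≤ (523 + 2635 * |c'|) * (alpha D * ell D) * (‖E‖ * (16 * Real.exp 9 * ell D ^ 4) * p) :=
          mul_le_mul (hw2 p hp') (by gcongr)
            (mul_nonneg (mul_nonneg (norm_nonneg _) hA0) (Nat.cast_nonneg _))
            (mul_nonneg (by positivity) (mul_pos hα hℓ0).le)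
      _ = K / ell D ^ 4 * p := by
          rw [hK]
          have : (523 + 2635 * |c'|) * (alpha D * ell D) *
              (‖E‖ * (16 * Real.exp 9 * ell D ^ 4) * (p : ℝ)) =
              (523 + 2635 * |c'|) * ‖E‖ * (16 * Real.exp 9) *
                (alpha D * ell D * ell D ^ 4) * p := by ring
          rw [this, hα5]; ring
  have hC' : ∀ p ∈ primeWindow D, ‖(w p + 1) * (E * frakA χ * p)‖ ≤ ε / 3 * p := fun p hp' =>
    (hC p hp').trans (mul_le_mul_of_nonneg_right hKε (Nat.cast_nonneg p))
  -- sum up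
  have hPnn : 0 ≤ frakP D := frakP_nonneg D
  rw [key]
  calc ‖(Phi2 c' χ - ∑ p ∈ primeWindow D, w p * Φ D χ p) +
        (∑ p ∈ primeWindow D, w p * (Φ D χ p + E * frakA χ * p) -
          ∑ p ∈ primeWindow D, (w p + 1) * (E * frakA χ * p))‖
      ≤ ‖Phi2 c' χ - ∑ p ∈ primeWindow D, w p * Φ D χ p‖ +
        (‖∑ p ∈ primeWindow D, w p * (Φ D χ p + E * frakA χ * p)‖ +
          ‖∑ p ∈ primeWindow D, (w p + 1) * (E * frakA χ * p)‖) :=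
        (norm_add_le _ _).trans (by gcongr; exact norm_sub_le _ _)
    _ ≤ ε / 3 * frakP D + (∑ p ∈ primeWindow D, ε / 3 * (frakA χ + 1) * (p : ℝ) +
          ∑ p ∈ primeWindow D, ε / 3 * (p : ℝ)) :=
        add_le_add e162 (add_le_add ((norm_sum_le _ _).trans (Finset.sum_le_sum hB))
          ((norm_sum_le _ _).trans (Finset.sum_le_sum hC')))
    _ = (ε / 3 + ε / 3 * (frakA χ + 1) + ε / 3) * frakP D := by
        rw [← Finset.mul_sum, ← Finset.mul_sum, frakP_eq_sum_primeWindow]; ring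
    _ ≤ (ε * (frakA χ + 1)) * frakP D := by
        apply mul_le_mul_of_nonneg_right _ hPnn
        have hthird : ε / 3 ≤ ε / 3 * (frakA χ + 1) := le_mul_of_one_le_right hε3.le hA1
        linarith
    _ = ε * (frakA χ + 1) * frakP D := by ring

end Generic

/-! ## On the typed E-nodes: the RT-03 × RT-05 producer for the pen -/

/-- **u045 in the relative reading, at the parameter `e″ = e1pp`, from (16.12) and the TWO-PIECE (16.16)
at the parameter** (E-form of zl-w16-p4's `step16_u045Rel_of_R2`; the `𝓡₂*𝓡₂ⱼ` display u044 being the tree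
theorem `ResidueValues.step16_u044_holds`, `𝔢`-free), NO size input on `𝔞`: for all large `D` under (A),
`‖Φ₂(p) + (𝔢₁[e1pp]+𝔢₂[e1pp])𝔞p‖ ≤ ε(𝔞+1)p` for `p ∼ P`. The second hypothesis is the node
`Typed.Section16B.Eq16_16R2E e1pp c′` BY NAME. [cite: Zhang2022LandauSiegel, §16 p.95] -/
theorem step16_u045RelE_of_R2E (e1pp : ℕ → ℂ) (c' : ℝ) (h1612 : Typed.Section16A.Eq16_12 c')
    (h16R2 : Typed.Section16B.Eq16_16R2E e1pp c') :
    ∀ ε : ℝ, 0 < ε → ForAllLarge fun D _ χ => AssumptionA D χ → ∀ p ∈ primeWindow D,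
      ‖Typed.Section16A.Phi2p c' χ p + (frakeE e1pp 1 + frakeE e1pp 2) * frakA χ * p‖ ≤
        ε * (frakA χ + 1) * p :=
  phi2p_evalRel_of_parts2_gen (frakeE e1pp) (fun _ _ χ p => Typed.Section16A.Phi2p c' χ p)
    (fun _ _ χ => Typed.Section16A.calR2star c' χ) (fun _ _ χ j => Typed.Section16A.calR2 c' χ j)
    (fun _ _ χ j => Typed.Section16A.calS2 c' χ j) h1612 h16R2 (ResidueValues.step16_u044_holds c')

/-- **RT-03 × RT-05 producer for the pen** (zl-skel, INBOX 2026-08-27T00:11:44Z: "§16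
`Skeleton.Eval1617RelE e1pp c'` (i.e. `eval1617Rel_of_R2E : Prop141 → Step16_u010 c' → Eq16_12 c' →
Eq16_16R2E e1pp c' → Eval1617RelE e1pp c'`)"; E-form of zl-w16-p4's `eval1617Rel_of_R2`, p474283):
Proposition 14.1 + u010 + (16.12) + the TWO-PIECE (16.16) at the parameter `e″ = e1pp` ⇒ (16.17)ᴿ at the
parameter, `Skeleton.Eval1617RelE e1pp c′` — (16.2) ⇐ Prop. 14.1 + u010 is `Skeleton.eq16_2_of_prop141`,
u043/u044 are tree theorems, the in-line `(pt₀)^{β₁} = −1 + O(α₁)` claim and the passage to (16.17)ᴿ are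
`eval1617Rel_of_parts_gen` (value of `𝔢ⱼ[e1pp]` never inspected). At `e1pp = AppendixB.e1ppD` this is the
producer of the E-rethread's `h1617` from the binder of record `h16_16 : Eq16_16R2E e1ppD c'`.
[cite: Zhang2022LandauSiegel, §16 (16.17) p.95] -/
theorem eval1617RelE_of_R2E (e1pp : ℕ → ℂ) (c' : ℝ) (h141 : Prop141)
    (h010 : Typed.Section16A.Step16_u010 c') (h1612 : Typed.Section16A.Eq16_12 c')
    (h16R2 : Typed.Section16B.Eq16_16R2E e1pp c') : Eval1617RelE e1pp c' :=
  eval1617Rel_of_parts_gen c' (frakeE e1pp 1 + frakeE e1pp 2)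
    (fun _ _ χ p => Typed.Section16A.Phi2p c' χ p)
    (eq16_2_of_prop141 c' h141 h010) (step16_u045RelE_of_R2E e1pp c' h1612 h16R2)

/-- The same with the argument order of the pen's note (`eval1617Rel_of_R2E`), `c′` first: a synonym.
[cite: Zhang2022LandauSiegel, §16 (16.17) p.95] -/
theorem eval1617Rel_of_R2E (c' : ℝ) (e1pp : ℕ → ℂ) (h141 : Prop141)
    (h010 : Typed.Section16A.Step16_u010 c') (h1612 : Typed.Section16A.Eq16_12 c')
    (h16R2 : Typed.Section16B.Eq16_16R2E e1pp c') : Eval1617RelE e1pp c' :=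
  eval1617RelE_of_R2E e1pp c' h141 h010 h1612 h16R2

-- Sanity (R-28 C4): at the STATED constant `e1pp = e1ppj` the E-producer IS the RT-03 precondition of
-- record, `Prop141 → Step16_u010 c′ → Eq16_12 c′ → Eq16_16R2 c′ → Eval1617Rel c′` — already landed as
-- zl-w16-p4's `Skeleton.eval1617Rel_of_eq16_16R2` (Section16Eval1617R2Named), so only checked here, not
-- restated (bridges `Typed.Section16B.eq16_16R2E_e1ppj`, `eval1617RelE_e1ppj_iff`, both `rfl`).
example (c' : ℝ) (h141 : Prop141) (h010 : Typed.Section16A.Step16_u010 c')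
    (h1612 : Typed.Section16A.Eq16_12 c') (h16R2 : Typed.Section16B.Eq16_16R2 c') :
    Eval1617Rel c' :=
  (eval1617RelE_e1ppj_iff c').mp
    (eval1617RelE_of_R2E e1ppj c' h141 h010 h1612
      ((Typed.Section16B.eq16_16R2E_e1ppj c').symm ▸ h16R2))

end Literature.NumberTheory.LFunctions.Zhang2022.Skeleton

end
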